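import Mathlib
import Literature.Probability.LatticeModels.LoopO1
import HarnessLib

/-!
# The "all-t" loop-O(1) join inequality is false (counterexample `C₄`, `t = 2`)

Topic `Literature/Probability/LatticeModels` (librarian move 2026-08-16 of the gate-parked module
`Literature/Uncategorized/LoopAizenmanAllT.lean`; declarations byte-identical, only the namespace —
this directory's — is new; the old names remain as deprecated aliases). The objects are the loop-O(1)
/ high-temperature-expansion partition functions `loopO1PartitionFunction G t S` and `tJoins` of
`Literature/Probability/LatticeModels/LoopO1.lean`.

* `Literature.Probability.LatticeModels.LoopAizenmanAllT` — the currents-free "all-t" strengthening of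
  the Aizenman-type join bound `StrandsJoinBound` (support item stmt-CriticalPhenomena-14647 of crux
  `JoinForcesU4`, stmt-CriticalPhenomena-14627, summit `CriticalPhenomena/Ising3DConformalLimit`):
  the polynomial inequality `Z^Q Z⁰ − (Z^{01}Z^{23} + Z^{02}Z^{13} + Z^{03}Z^{12}) ≤ −2·JointSum_t`
  asked for EVERY weight `t ≥ 0` instead of `t = tanh β ∈ [0,1)`. A refuted strengthening, kept as
  the named target of its refutation (negative knowledge; not a literature fact, no `_holds`).
* `Literature.Probability.LatticeModels.not_LoopAizenmanAllT` — **it is FALSE**: on `cycleGraph 4`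
  with the two source pairs as edges, at `t = 2`, `8·17 − (10·10 + 8·8 + 10·10) = −128 > −192`;
  in general `RHS − LHS = 2t⁴(2 − t²)` there, so the inequality fails for every `t > √2` and the
  restriction `t = tanh β ≤ 1` is load-bearing: no weight-preserving `T`-join bijection / XOR
  argument valid for all `t` can prove `StrandsJoinBound`. All loop data are kernel-computed
  (helper lemmas in the namespace `LoopAizenmanAllT`: `C4`, `tJoins_univ_eq`, `loopZ_C4_two`,
  `zQ`…`z12`, `tJoins01`, `tJoins23`, `reachable_invariant`, `fromEdgeSet_union_adj`, `jointSum_C4_two`).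

Origin: standing disprover of crux `JoinForcesU4`, proposal relocated by the gate out of
`Summits/CriticalPhenomena/Ising3DConformalLimit/Theorems/JoinForcesU4/Negative/AllTStrengthening.lean`
(2026-08-15). No module imports the parked copy.
-/

namespace Literature.Probability.LatticeModels

open Finset SimpleGraph

/-- The currents-free "all-t" strengthening of `StrandsJoinBound`: through the high-temperature expansion
`⟨σ_S⟩^free_G = Z^S_t / Z⁰_t` (`t = tanh β`, `Z^S_t = loopO1PartitionFunction G t S`) the support
`StrandsJoinBound` reads `Z^Q Z⁰ − (Z^{01}Z^{23} + Z^{02}Z^{13} + Z^{03}Z^{12}) ≤ −2·JointSum_t` at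
`t = tanh β ∈ [0,1)`; the strengthening asks the same polynomial inequality for EVERY weight `t ≥ 0`. [folklore] -/
def LoopAizenmanAllT : Prop :=
  ∀ (V : Type) [Fintype V] [DecidableEq V] (G : SimpleGraph V) [DecidableRel G.Adj] (t : ℝ), 0 ≤ t →
    ∀ a : Fin 4 → V, Function.Injective a →
      loopO1PartitionFunction G t {a 0, a 1, a 2, a 3} * loopO1PartitionFunction G t ∅ -
        (loopO1PartitionFunction G t {a 0, a 1} * loopO1PartitionFunction G t {a 2, a 3} +
         loopO1PartitionFunction G t {a 0, a 2} * loopO1PartitionFunction G t {a 1, a 3} +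
         loopO1PartitionFunction G t {a 0, a 3} * loopO1PartitionFunction G t {a 1, a 2}) ≤
      -(2 * ∑ F₁ ∈ tJoins G Set.univ {a 0, a 1}, ∑ F₂ ∈ tJoins G Set.univ {a 2, a 3},
          open scoped Classical in
          if (SimpleGraph.fromEdgeSet ((↑F₁ : Set (Sym2 V)) ∪ ↑F₂)).Reachable (a 0) (a 2)
          then t ^ (F₁.card + F₂.card) else 0)

namespace LoopAizenmanAllT

/-- The 4-cycle `0–1–2–3–0` (pairs `{0,1}`, `{2,3}` are EDGES). [folklore] -/
abbrev C4 : SimpleGraph (Fin 4) := SimpleGraph.cycleGraph 4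

/-- `tJoins_univ_eq` (loop data of `C4 = cycleGraph 4` at `t = 2`, kernel-computed). [folklore] -/
theorem tJoins_univ_eq {V : Type*} [Fintype V] [DecidableEq V] (G : SimpleGraph V) [DecidableRel G.Adj]
    (A : Finset V) :
    tJoins G Set.univ A = G.edgeFinset.powerset.filter (fun F => oddDegVerts F = A) := by
  ext F
  rw [mem_tJoins_iff_oddDegVerts, Finset.mem_filter, Finset.mem_powerset]
  simp

/-- `Z^A_{C4}(2)` as a natural-number sum (kernel-computable). [folklore] -/
theorem loopZ_C4_two (A : Finset (Fin 4)) :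
    loopO1PartitionFunction C4 2 A =
      (((C4.edgeFinset.powerset.filter (fun F => oddDegVerts F = A)).sum (fun F => 2 ^ F.card) : ℕ) : ℝ) := by
  rw [loopO1PartitionFunction]
  have h : ∀ F ∈ C4.edgeFinset.powerset, loopO1Weight C4 2 A F =
      if oddDegVerts F = A then (2:ℝ) ^ F.card else 0 := by
    intro F hF
    have hF' : F ⊆ C4.edgeFinset := Finset.mem_powerset.1 hF
    simp only [loopO1Weight, tJoins_univ_eq, Finset.mem_filter, Finset.mem_powerset, hF', true_and]
  rw [Finset.sum_congr rfl h, ← Finset.sum_filter]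
  push_cast
  rfl

/-- `zQ` (loop data of `C4 = cycleGraph 4` at `t = 2`, kernel-computed). [folklore] -/
theorem zQ : loopO1PartitionFunction C4 2 {0, 1, 2, 3} = 8 := by
  rw [loopZ_C4_two]; exact_mod_cast (by decide : ((C4.edgeFinset.powerset.filter
    (fun F => oddDegVerts F = ({0, 1, 2, 3} : Finset (Fin 4)))).sum (fun F => 2 ^ F.card) : ℕ) = 8)
/-- `z0` (loop data of `C4 = cycleGraph 4` at `t = 2`, kernel-computed). [folklore] -/
theorem z0 : loopO1PartitionFunction C4 2 ∅ = 17 := by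
  rw [loopZ_C4_two]; exact_mod_cast (by decide : ((C4.edgeFinset.powerset.filter
    (fun F => oddDegVerts F = (∅ : Finset (Fin 4)))).sum (fun F => 2 ^ F.card) : ℕ) = 17)
/-- `z01` (loop data of `C4 = cycleGraph 4` at `t = 2`, kernel-computed). [folklore] -/
theorem z01 : loopO1PartitionFunction C4 2 {0, 1} = 10 := by
  rw [loopZ_C4_two]; exact_mod_cast (by decide : ((C4.edgeFinset.powerset.filter
    (fun F => oddDegVerts F = ({0, 1} : Finset (Fin 4)))).sum (fun F => 2 ^ F.card) : ℕ) = 10)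
/-- `z23` (loop data of `C4 = cycleGraph 4` at `t = 2`, kernel-computed). [folklore] -/
theorem z23 : loopO1PartitionFunction C4 2 {2, 3} = 10 := by
  rw [loopZ_C4_two]; exact_mod_cast (by decide : ((C4.edgeFinset.powerset.filter
    (fun F => oddDegVerts F = ({2, 3} : Finset (Fin 4)))).sum (fun F => 2 ^ F.card) : ℕ) = 10)
/-- `z02` (loop data of `C4 = cycleGraph 4` at `t = 2`, kernel-computed). [folklore] -/
theorem z02 : loopO1PartitionFunction C4 2 {0, 2} = 8 := by
  rw [loopZ_C4_two]; exact_mod_cast (by decide : ((C4.edgeFinset.powerset.filter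
    (fun F => oddDegVerts F = ({0, 2} : Finset (Fin 4)))).sum (fun F => 2 ^ F.card) : ℕ) = 8)
/-- `z13` (loop data of `C4 = cycleGraph 4` at `t = 2`, kernel-computed). [folklore] -/
theorem z13 : loopO1PartitionFunction C4 2 {1, 3} = 8 := by
  rw [loopZ_C4_two]; exact_mod_cast (by decide : ((C4.edgeFinset.powerset.filter
    (fun F => oddDegVerts F = ({1, 3} : Finset (Fin 4)))).sum (fun F => 2 ^ F.card) : ℕ) = 8)
/-- `z03` (loop data of `C4 = cycleGraph 4` at `t = 2`, kernel-computed). [folklore] -/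
theorem z03 : loopO1PartitionFunction C4 2 {0, 3} = 10 := by
  rw [loopZ_C4_two]; exact_mod_cast (by decide : ((C4.edgeFinset.powerset.filter
    (fun F => oddDegVerts F = ({0, 3} : Finset (Fin 4)))).sum (fun F => 2 ^ F.card) : ℕ) = 10)
/-- `z12` (loop data of `C4 = cycleGraph 4` at `t = 2`, kernel-computed). [folklore] -/
theorem z12 : loopO1PartitionFunction C4 2 {1, 2} = 10 := by
  rw [loopZ_C4_two]; exact_mod_cast (by decide : ((C4.edgeFinset.powerset.filter
    (fun F => oddDegVerts F = ({1, 2} : Finset (Fin 4)))).sum (fun F => 2 ^ F.card) : ℕ) = 10)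

/-- The `T`-joins of `{0,1}` in `C4`: the edge `01` and the long way round. [folklore] -/
theorem tJoins01 : tJoins C4 Set.univ ({0, 1} : Finset (Fin 4)) =
    { {s(0, 1)}, {s(1, 2), s(2, 3), s(0, 3)} } := by
  rw [tJoins_univ_eq]; decide

/-- The `T`-joins of `{2,3}` in `C4`. [folklore] -/
theorem tJoins23 : tJoins C4 Set.univ ({2, 3} : Finset (Fin 4)) =
    { {s(2, 3)}, {s(1, 2), s(0, 1), s(0, 3)} } := by
  rw [tJoins_univ_eq]; decide

/-- Reachability is constant on classes of a function that is constant along edges. [folklore] -/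
theorem reachable_invariant {V : Type*} {G : SimpleGraph V} (f : V → Bool)
    (hf : ∀ u v, G.Adj u v → f u = f v) {u v : V} (h : G.Reachable u v) : f u = f v := by
  obtain ⟨p⟩ := h
  induction p with
  | nil => rfl
  | cons ha _ ih => exact (hf _ _ ha).trans ih

/-- Adjacency in `fromEdgeSet` of a union of two explicit finsets, made decidable-friendly. [folklore] -/
theorem fromEdgeSet_union_adj {V : Type*} (F₁ F₂ : Finset (Sym2 V)) (u v : V) :
    (SimpleGraph.fromEdgeSet ((↑F₁ : Set (Sym2 V)) ∪ ↑F₂)).Adj u v ↔ (s(u, v) ∈ F₁ ∨ s(u, v) ∈ F₂) ∧ u ≠ v := by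
  rw [SimpleGraph.fromEdgeSet_adj, Set.mem_union, Finset.mem_coe, Finset.mem_coe]

/-- The joint sum on `C4` at `t = 2`: `2⁴ + 2⁴ + 2⁶ = 96` (the pair `({01},{23})` does not join `0` to `2`). [folklore] -/
theorem jointSum_C4_two :
    (∑ F₁ ∈ tJoins C4 Set.univ ({0, 1} : Finset (Fin 4)), ∑ F₂ ∈ tJoins C4 Set.univ ({2, 3} : Finset (Fin 4)),
      open scoped Classical in
      if (SimpleGraph.fromEdgeSet ((↑F₁ : Set (Sym2 (Fin 4))) ∪ ↑F₂)).Reachable 0 2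
      then (2:ℝ) ^ (F₁.card + F₂.card) else 0) = 96 := by
  classical
  rw [tJoins01, tJoins23]
  rw [Finset.sum_pair (by decide), Finset.sum_pair (by decide), Finset.sum_pair (by decide)]
  -- the four reachability facts
  have hA : ¬ (SimpleGraph.fromEdgeSet ((↑({s(0, 1)} : Finset (Sym2 (Fin 4))) : Set (Sym2 (Fin 4))) ∪
      ↑({s(2, 3)} : Finset (Sym2 (Fin 4))))).Reachable 0 2 := by
    intro h
    have := reachable_invariant (G := SimpleGraph.fromEdgeSet ((↑({s(0, 1)} : Finset (Sym2 (Fin 4))) :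
      Set (Sym2 (Fin 4))) ∪ ↑({s(2, 3)} : Finset (Sym2 (Fin 4)))))
      (fun v : Fin 4 => decide (v = 0 ∨ v = 1)) (fun u v huv => ?_) h
    · revert this; decide
    · rw [fromEdgeSet_union_adj] at huv
      revert u v; decide
  have adj : ∀ (F₁ F₂ : Finset (Sym2 (Fin 4))) (u v : Fin 4), (s(u, v) ∈ F₁ ∨ s(u, v) ∈ F₂) → u ≠ v →
      (SimpleGraph.fromEdgeSet ((↑F₁ : Set (Sym2 (Fin 4))) ∪ ↑F₂)).Reachable u v :=
    fun F₁ F₂ u v h hne => ((fromEdgeSet_union_adj F₁ F₂ u v).2 ⟨h, hne⟩).reachable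
  have hB : (SimpleGraph.fromEdgeSet ((↑({s(0, 1)} : Finset (Sym2 (Fin 4))) : Set (Sym2 (Fin 4))) ∪
      ↑({s(1, 2), s(0, 1), s(0, 3)} : Finset (Sym2 (Fin 4))))).Reachable 0 2 :=
    (adj _ _ 0 1 (by decide) (by decide)).trans (adj _ _ 1 2 (by decide) (by decide))
  have hC : (SimpleGraph.fromEdgeSet ((↑({s(1, 2), s(2, 3), s(0, 3)} : Finset (Sym2 (Fin 4))) :
      Set (Sym2 (Fin 4))) ∪ ↑({s(2, 3)} : Finset (Sym2 (Fin 4))))).Reachable 0 2 :=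
    (adj _ _ 0 3 (by decide) (by decide)).trans (adj _ _ 3 2 (by decide) (by decide))
  have hD : (SimpleGraph.fromEdgeSet ((↑({s(1, 2), s(2, 3), s(0, 3)} : Finset (Sym2 (Fin 4))) :
      Set (Sym2 (Fin 4))) ∪ ↑({s(1, 2), s(0, 1), s(0, 3)} : Finset (Sym2 (Fin 4))))).Reachable 0 2 :=
    (adj _ _ 0 3 (by decide) (by decide)).trans (adj _ _ 3 2 (by decide) (by decide))
  rw [if_neg hA, if_pos hB, if_pos hC, if_pos hD]
  simp only [Finset.card_singleton]
  rw [show ({s(1, 2), s(2, 3), s(0, 3)} : Finset (Sym2 (Fin 4))).card = 3 by decide,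
    show ({s(1, 2), s(0, 1), s(0, 3)} : Finset (Sym2 (Fin 4))).card = 3 by decide]
  norm_num

end LoopAizenmanAllT

open LoopAizenmanAllT in
/-- **`LoopAizenmanAllT` is FALSE** (refuted strengthening; negative knowledge for crux
`stmt-CriticalPhenomena-14627` / support `StrandsJoinBound`, item 14647): on `cycleGraph 4` with the two
source pairs as edges, at `t = 2`, `Z^Q Z⁰ − ΣZZ = 8·17 − (10·10 + 8·8 + 10·10) = −128 > −192 = −2·96`;
there `RHS − LHS = 2t⁴(2 − t²)`, so the polynomial inequality fails for every `t > √2`. Hence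
`t = tanh β ≤ 1` (the even dressing of currents) is load-bearing in `StrandsJoinBound`: no
weight-preserving `T`-join bijection / XOR argument valid for all `t` can prove it. All loop data are
kernel-computed (`decide` over `ℕ`-valued sums). [folklore] -/
theorem not_LoopAizenmanAllT : ¬ LoopAizenmanAllT := by
  intro h
  have h4 := h (Fin 4) C4 2 (by norm_num) (fun i => i) (fun _ _ e => e)
  rw [zQ, z0, z01, z23, z02, z13, z03, z12, jointSum_C4_two] at h4
  norm_num at h4

end Literature.Probability.LatticeModels
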